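import Summits.CriticalPhenomena.PercolationContinuityZ3.Theorems.PercNearOneGluingNoHeavyQuantRootScaledResidualPatterns
import Summits.CriticalPhenomena.PercolationContinuityZ3.Theorems.PercNearOneGluingNoHeavyQuantRootScaledExpansionStep
import HarnessLib

/-!
# QUANT lane R8, T-DEC: THE TOP-LEVEL ROOT-SCALED EXPANSION, part 4 — the first certified regime of claim (II): below the PAIR threshold the
# residual re-gates to the target, so forests of siblings with EQUAL root gates and `q·Σ mᵢ ≤ 2·min mᵢ` are SDEC (identical siblings: `k·q ≤ 2`) —
# the residual route DOUBLES the light-root regime of `sdec_flaw_lightRoots` (lead g46 README V428 (2)–(3); arm-1 gen 48)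

builds on p205010 (kernel theorem, internal audit signed; external expert review pending)

Support file (`--supports stmt-CriticalPhenomena-4575`), QUANT lane seat prim-quant-arm-1 (gen 48, architect), rung R8 of
`run/shared/lean/prim/quant/LADDER.md`; memo `run/shared/lean/prim/quant/prim-quant-arm-1-g48/ARCH-G48.md` §3, §6.  Theorems only (no definitions, no
`@[conjecture]`), standard axioms, no sorries.  Sequel of `…QuantRootScaledResidualPatterns` (`resid_rootPattern`) and `…QuantRootScaledExpansionStep`
(`decAt_gate_flaw_of_resid`, `decAt_flaw_of_sdec`); uses typer g39's re-gating lemma with a dead mass (`decAt_gate_of_regate₀`, at outer gate `1`).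

THE USE OF THE RESIDUAL'S PATTERN MIXTURE `resid a w L = ν₀·δ₀ + Σ_U ν_U·F_U` (`F_U` the opened sub-forests of the open-root set `U`, SDEC by the oracle
of the sibling step, mean `s_U ≥ |U|·Smin L`): if every CHARGED piece is heavy enough, `a·fmean L ≤ s_U`, the residual re-gates piece by piece to the
common target `a·fmean L` and is DEC at floor `a·x` at every layer below the top (`decAt_resid_of_regime`; floors: the uniform check `x·Stot ≤ fmean·xmin`
of the re-gating families).  Charged pieces have `|U| ≥ 1` always (regime `a·fmean ≤ Smin` — nothing beyond `decAt_gate_flaw_rootPattern`) and `|U| ≥ 2`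
for EQUAL root gates with `w = wco a L` (regime `a·fmean ≤ 2·Smin` — NEW: all single-root patterns are spent on the free product part `flaw Lₐ`).  With
part 2's `decAt_gate_flaw_of_resid`: **`decAt_gate_flaw_equalRoots`** (equal root gates, `0 < a < 1`, `a·fmean L ≤ 2·Smin L` ⟹ `gate (flaw L) a` DEC at
`a·x` at every layer below the top — claims (I) ∪ (II) of README V428 (3) IN THE KERNEL for `a ≤ 2·Smin/fmean`, e.g. `a ≤ 2/(3q)` on identical triples;
the floor check is automatic for equal gates, `floor_check_of_const`) and **`sdec_flaw_equalRoots`**: EQUAL ROOT GATES and `fmean L ≤ 2·Smin L`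
(identical siblings: `k·q ≤ 2`, vs `k·q ≤ 1` of `sdec_flaw_lightRoots`) ⟹ `SDEC x (ftop L) (flaw L)` — the list form of `SiblingStep` on this family,
every width.  Above the pair threshold the pair mass of the residual cannot be carried by any column built from the opened sub-forests with the right
mean AND floor (memo §3): certifying (II) there is count-level work (census-2's gated blob forests / re-tuned leaves), not done here.

* `Smin_nonneg`, `fmean_of_const`, `floor_check_of_const`;
* **`decAt_resid_of_regime`**, **`decAt_gate_flaw_equalRoots`**, **`sdec_flaw_equalRoots`**.

HONEST STATUS: a certified sub-family (equal root gates below the pair threshold); `SiblingStep`, `GateStepN`, `FarTreeRow` OPEN; RATE class log\* /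
honest sentence of `run/shared/lean/prim/quant/README.md` unchanged.  [this work]; re-gating lemma: prim-quant-stmt g39; programme (I)–(II): prim-quant-lead
g46.  Nothing here is cited as a published result.  The gluing rows served [cite: KozmaNitzan2024, Conjecture 3 (p. 15)]; product measure
[cite: Grimmett1999, §1.3 p. 10].
-/

noncomputable section

open scoped BigOperators

namespace Summit.CriticalPhenomena.PercolationContinuityZ3.Theorems
namespace Quant
namespace LawDec

open Finset

/-! ### Tools for equal root gates -/

/-- the least opened mean of tree-built composite siblings is nonnegative. [this work] -/
theorem Smin_nonneg {x : ℝ} : ∀ L : List Sib, (∀ s ∈ L, s.TreeOK x) → 0 ≤ Smin L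
  | [], _ => le_rfl
  | [s], hL => (s.mean_pos (hL s List.mem_cons_self)).le
  | s :: t :: L, hL =>
    le_min (s.mean_pos (hL s List.mem_cons_self)).le (Smin_nonneg (t :: L) fun u hu => hL u (List.mem_cons_of_mem s hu))

/-- for equal root gates `q₀` the forest mean is `q₀·Stot`. [this work] -/
theorem fmean_of_const (q₀ : ℝ) : ∀ L : List Sib, (∀ u ∈ L, u.q = q₀) → fmean L = q₀ * Stot L
  | [], _ => by simp [fmean, Stot]
  | s :: L, h => by
    simp only [fmean, Stot, fmean_of_const q₀ L (fun u hu => h u (List.mem_cons_of_mem s hu)), h s List.mem_cons_self]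
    ring

/-- for equal root gates the uniform floor check `x·Stot ≤ fmean·xmin` of the re-gating families is AUTOMATIC (`x ≤ q₀·x₁ᵢ` for every member).
[this work] -/
theorem floor_check_of_const {x : ℝ} (q₀ : ℝ) (L : List Sib) (hL : ∀ s ∈ L, s.TreeOK x) (h : ∀ u ∈ L, u.q = q₀) :
    x * Stot L ≤ fmean L * xmin L := by
  have hxm : ∀ L' : List Sib, (∀ s ∈ L', s.TreeOK x) → (∀ u ∈ L', u.q = q₀) → L' ≠ [] → x ≤ q₀ * xmin L' := by
    intro L'
    induction L' with
    | nil => intro _ _ hne; exact absurd rfl hne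
    | cons s L' ih =>
      intro hL' h' _
      obtain ⟨hsq0, _, hxq, hT, _⟩ := hL' s List.mem_cons_self
      obtain ⟨_, hx₁1, _, _, _, _⟩ := hT.lawFacts
      have hq0 : 0 < q₀ := by rw [← h' s List.mem_cons_self]; exact hsq0
      rw [h' s List.mem_cons_self] at hxq
      simp only [xmin]
      rw [mul_min_of_nonneg _ _ hq0.le]
      refine le_min hxq ?_
      by_cases hne : L' = []
      · subst hne; simp only [xmin]; nlinarith
      · exact ih (fun u hu => hL' u (List.mem_cons_of_mem s hu)) (fun u hu => h' u (List.mem_cons_of_mem s hu)) hne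
  rcases eq_or_ne L [] with rfl | hne
  · simp [Stot, fmean]
  · have hS0 := Stot_nonneg L (fun s hs => (hL s hs).lawOK)
    rw [fmean_of_const q₀ L h]
    nlinarith [mul_le_mul_of_nonneg_right (hxm L hL h hne) hS0]


/-! ### The certified regime of claim (II): the residual re-gates below the pair threshold -/

/-- **THE RESIDUAL IS DEC WHEN EVERY CHARGED PIECE IS HEAVY ENOUGH.**  Tree-built siblings at floor `0 < x < 1`, `L ≠ []`, the oracle below
`fgates L`, `0 < a ≤ 1`, a weight `w ≤ wco a L`, `w < 1`, the uniform floor check `x·Stot ≤ fmean·xmin`, and the REGIME: either `a·fmean L ≤ Smin L`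
(every pattern is heavy), or EQUAL root gates with `w = wco a L` and `a·fmean L ≤ 2·Smin L` (single-root pieces carry no weight; the others have
`|U| ≥ 2`).  Then `resid a w L` is DEC at floor `a·x` at every layer below the top (re-gating lemma at outer gate `1`, pieces SDEC by the oracle). [this work] -/
theorem decAt_resid_of_regime {x a w : ℝ} (hx0 : 0 < x) (hx1 : x < 1) (ha0 : 0 < a) (ha1 : a ≤ 1) (L : List Sib) (hne : L ≠ [])
    (hL : ∀ s ∈ L, s.TreeOK x)
    (hO : ∀ (x' : ℝ) (n' M' : ℕ) (μ' : ℕ → ℝ), n' < fgates L → TreeBuiltN x' n' M' μ' → SDEC x' M' μ')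
    (hw : w ≤ wco a L) (hw1 : w < 1) (hfl : x * Stot L ≤ fmean L * xmin L)
    (hreg : a * fmean L ≤ Smin L ∨ ((∃ q₀ : ℝ, ∀ u ∈ L, u.q = q₀) ∧ w = wco a L ∧ a * fmean L ≤ 2 * Smin L)) :
    ∀ j, j < ftop L → DECAt (a * x) j (ftop L) (resid a w L) := by
  classical
  intro j hj
  have hL' : ∀ s ∈ L, s.LawOK := fun s hs => (hL s hs).lawOK
  obtain ⟨ν₀, ι, _, ν, c, t, m, s, y, F, hν00, hν0, hν1, hmix, hνs, hsing, hP⟩ := resid_rootPattern hx0 hx1 ha0 ha1 L hL hw hw1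
  obtain ⟨_, _, _, rmn⟩ := resid_laws ha0 ha1 L hL' hw hw1
  have hS0 : 0 < a * fmean L := mul_pos ha0 ((fmean_pos L hL).2 hne)
  have hSmin0 : 0 ≤ Smin L := Smin_nonneg L hL
  -- `ν₀ < 1`: otherwise all pieces are uncharged and the mean would vanish
  have hν01 : ν₀ < 1 := by
    by_contra hge
    have hsum0 : ∑ i, ν i = 0 := by linarith [Finset.sum_nonneg fun i (_ : i ∈ Finset.univ) => hν0 i, not_lt.1 hge]
    have hz : ∀ i, ν i = 0 := fun i => (Finset.sum_eq_zero_iff_of_nonneg fun i _ => hν0 i).1 hsum0 i (Finset.mem_univ i)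
    have : ∑ i, ν i * s i = 0 := Finset.sum_eq_zero fun i _ => by rw [hz i, zero_mul]
    linarith
  have key := decAt_gate_of_regate₀ (ftop L) (resid a w L) ν₀ ν F t s y (S := a * fmean L) (x := a * x) (a := 1) hν01 hν0 hν1 hmix
    hνs hS0 rmn (fun i _ => ?_) (mul_pos ha0 hx0) one_pos (fun i hi => ?_) (fun i _ => ?_) j hj
  · rwa [gate_one, one_mul] at key
  · obtain ⟨hti, F0, FM, F1, Fmean, _, _, _, _, hTF, _, _, hyt, hmg⟩ := hP i
    obtain ⟨hy0', hy1', _, _, _, _⟩ := hTF.lawFacts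
    exact ⟨hti, F0, FM, F1, Fmean, hy0', hy1', hyt, hO (y i) (m i) (t i) (F i) (by omega) hTF⟩
  · rw [one_mul]
    obtain ⟨_, _, _, _, _, hci, hSmin, hcS, _, _, _, _, _, _⟩ := hP i
    rcases hreg with hreg | ⟨⟨q₀, hq⟩, hwe, hreg⟩
    · exact hreg.trans hSmin
    · have hc1 : c i ≠ 1 := fun hc => (ne_of_gt hi) (hsing q₀ hq hwe i hc)
      have hc2 : (2 : ℝ) ≤ c i := by exact_mod_cast (show 2 ≤ c i by omega)
      nlinarith
  · obtain ⟨_, _, _, _, _, _, _, _, hStot, _, hxm, _, _, _⟩ := hP i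
    have h1 : x * s i ≤ x * Stot L := mul_le_mul_of_nonneg_left hStot hx0.le
    have h2 : fmean L * xmin L ≤ fmean L * y i := mul_le_mul_of_nonneg_left hxm (fmean_pos L hL).1
    nlinarith [mul_le_mul_of_nonneg_left (h1.trans (hfl.trans h2)) ha0.le]

/-- **EQUAL ROOT GATES BELOW THE PAIR THRESHOLD: the node's obligation at outer gate `a`.**  Tree-built siblings with a common root gate, `L ≠ []`, the
oracle below `fgates L`, `0 < a < 1` and `a·fmean L ≤ 2·Smin L`: `gate (flaw L) a` is DEC at floor `a·x` at every layer below the top (product part free,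
residual re-gated; the floor check is automatic for equal gates). [this work] -/
theorem decAt_gate_flaw_equalRoots {x a q₀ : ℝ} (hx0 : 0 < x) (hx1 : x < 1) (ha0 : 0 < a) (ha1 : a < 1) (L : List Sib) (hne : L ≠ [])
    (hL : ∀ s ∈ L, s.TreeOK x) (hq : ∀ u ∈ L, u.q = q₀)
    (hO : ∀ (x' : ℝ) (n' M' : ℕ) (μ' : ℕ → ℝ), n' < fgates L → TreeBuiltN x' n' M' μ' → SDEC x' M' μ')
    (hreg : a * fmean L ≤ 2 * Smin L) :
    ∀ j, j < ftop L → DECAt (a * x) j (ftop L) (gate (flaw L) a) := by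
  have hL' : ∀ s ∈ L, s.LawOK := fun s hs => (hL s hs).lawOK
  obtain ⟨hW0, _, _⟩ := wco_facts ha1.le L hL'
  -- `wco < 1`: one sibling would make `a·fmean ≤ 2·Smin` read `a q₀ m ≤ 2 m`, but we need two for `wco < 1`; with one sibling the gated tree is free anyway
  intro j hj
  rcases L with _ | ⟨s, _ | ⟨t, L⟩⟩
  · exact absurd rfl hne
  · -- one sibling: `gate (flaw [s]) a = gate ρ (a q₀)`, SDEC of `ρ` by the oracle
    obtain ⟨hsq0, hsq1, hxq, hT, _⟩ := hL s List.mem_cons_self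
    obtain ⟨_, hx₁1, ρ0, ρM, ρ1, ρta⟩ := hT.lawFacts
    obtain ⟨_, gM, _⟩ := gate_laws s.M s.ρ s.q hsq0.le hsq1.le ρ0 ρM ρ1
    have e1 : flaw [s] = gate s.ρ s.q := by
      funext k; simp only [flaw, ftop]; exact lconv_delta_left 0 s.M _ gM k
    have hS : SDEC s.x₁ s.M s.ρ := hO s.x₁ s.n s.M s.ρ (by simp [fgates]) hT
    have htop : ftop [s] = s.M := by simp [ftop]
    rw [htop] at hj ⊢
    rw [e1, gate_gate]
    have d := hS (a * s.q) (mul_pos ha0 hsq0) (by nlinarith) j hj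
    exact decAt_mono_floor (by nlinarith [mul_le_mul_of_nonneg_left hxq ha0.le]) (by nlinarith) d
  · have hlt : wco a (s :: t :: L) < 1 := wco_lt_one ha1 s t L hL'
    exact decAt_gate_flaw_of_resid hx0 hx1 ha0 ha1.le (s :: t :: L) hL (sdec_members_of_oracle _ hL hO) hW0.le le_rfl hlt
      (decAt_resid_of_regime hx0 hx1 ha0 ha1.le (s :: t :: L) hne hL hO le_rfl hlt (floor_check_of_const q₀ _ hL hq)
        (Or.inr ⟨⟨q₀, hq⟩, rfl, hreg⟩)) j hj

/-- **THE SIBLING STEP FOR EQUAL ROOT GATES BELOW THE PAIR THRESHOLD (any width).**  Tree-built siblings at floor `0 < x < 1` with a common root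
gate `q₀`, GIVEN the oracle below `fgates L`: if `fmean L ≤ 2·Smin L` (`q₀·Σ mᵢ ≤ 2·min mᵢ`; identical siblings: `k·q₀ ≤ 2` — twice the light-root
regime `k·q₀ ≤ 1` of `sdec_flaw_lightRoots`), then `flaw L` is SDEC at `x` — the list form of `SiblingStep` on this family. [this work] -/
theorem sdec_flaw_equalRoots {x q₀ : ℝ} (hx0 : 0 < x) (hx1 : x < 1) (L : List Sib) (hL : ∀ s ∈ L, s.TreeOK x) (hq : ∀ u ∈ L, u.q = q₀)
    (hO : ∀ (x' : ℝ) (n' M' : ℕ) (μ' : ℕ → ℝ), n' < fgates L → TreeBuiltN x' n' M' μ' → SDEC x' M' μ')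
    (hlight : fmean L ≤ 2 * Smin L) : SDEC x (ftop L) (flaw L) := by
  intro a ha0 ha1 j hj
  have hne : L ≠ [] := by rintro rfl; simp [ftop] at hj
  rcases eq_or_lt_of_le ha1 with rfl | hlt
  · rw [gate_one, one_mul]
    exact decAt_flaw_of_sdec hx0 hx1 L hL (sdec_members_of_oracle L hL hO) j
  · refine decAt_gate_flaw_equalRoots hx0 hx1 ha0 hlt L hne hL hq hO ?_ j hj
    have : a * fmean L ≤ 1 * fmean L := mul_le_mul_of_nonneg_right ha1 (fmean_pos L hL).1
    linarith


end LawDec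
end Quant
end Summit.CriticalPhenomena.PercolationContinuityZ3.Theorems
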